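/-
COR-CM (cell pub-hodgecm2) — RSCONJ («`RecordSystem.conj`», IDENT-LEMMA component (e) «SPACE by construction»): HEAD FILE, row A of the
RSCONJ table — `RecordSystemConj.exists_conj`.  Lead pen prover-pub-hodgecm2-mukey-p6-g1-0 (filer); this head assembled by
prover-pub-hodgeaudit-ident-2-g0-0 (checker witness adopted as mainline, RULING (3) HOME∕INBOX l.15599; «b» mukey-p10 l.15596).
KERNEL: one small definition by explicit formula (`eWitness`, a `NatIso.ofComponents`) + theorems; explicit binders; no instance, no named
fact, no notation, no `sorry`.  HC_CM is NOT proved; HELD — WORLD = C FINAL; this file discharges no END binder and claims nothing about (iv-c).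
-/
import Summits.HodgeConjecture.CorCM.B01.Transposition.HComp.RecordSystemConjAssembly
import Summits.HodgeConjecture.CorCM.B01.Transposition.HComp.RecordSystemConjComplex
import Summits.HodgeConjecture.CorCM.B01.Transposition.HComp.RecordSystemConjSwap
import Summits.HodgeConjecture.CorCM.D2Bridge.MuConjIdentificationSpace
import HarnessLib

/-!
# The conjugate record system exists: `RecordSystemConj.exists_conj`

For a Deligne record system `R : RecordSystem L H τ T hT K₀` of `Sh(U(H), 𝔹²)` ([Deligne1979ShimuraVarieties] 2.2.4–2.2.5, typed in
`UnitaryShimuraCanonicalModel`), there is a record system `R'` of the CONJUGATE hermitian space `(c(H), τ, T̄)` below the transported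
threshold `c(K₀)` whose model functor IS `K' ↦ M_{c⁻¹K'} ⊗_{L,c} L` (on the nose).  Proof = ONE application of the RSCONJ assembly
`exists_conj_of_complexSide` (mukey-p6, `RecordSystemConjAssembly`) at the conjugate complex record system
`conjComplexRecordSystem R.complexRecordSystem` (prove-5, `RecordSystemConjComplex`) with the transfer data of `RecordSystemConjSwap`
(ident-2): `e := eWitness R` (the base-change swap, whiskered), `Θ := Ident2Witness.theta`, (E) `theta_smul` fed the FRAME's
`conjAlgEquiv_apply`, (P) the point-formula square after the `rfl`-unfolding `conjComplexRecordSystem_pts_symm_mk_record`.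

References: [Deligne1979ShimuraVarieties] 2.2.4–2.2.5; [Milne2005ShimuraVarieties] §12 (62), Lemma 5.13; [GortzWedhorn2020] Prop. 4.16.
-/

set_option autoImplicit false

noncomputable section

open CategoryTheory AlgebraicGeometry NumberField IsDedekindDomain Matrix
open Literature.AlgebraicGeometry.Motives
open Literature.NumberTheory.Automorphic.Liu2021.AppendixC (C5.OpenCompactSubgroup C5.SmallLevel)

namespace Summit.HodgeConjecture.CorCM.Model.RecordSystemConj

section Head

open Literature.AlgebraicGeometry.ShimuraVarieties Literature.AlgebraicGeometry.ShimuraVarieties.UnitaryCanonicalModel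
open Literature.AlgebraicGeometry.Motives.AlgPoints (toConjugate)
open Literature.NumberTheory.Automorphic Literature.NumberTheory.Automorphic.UnitaryGroup
open Literature.NumberTheory.Automorphic.ShimuraDissection
open Literature.Geometry.ComplexHyperbolic Literature.Geometry.ComplexHyperbolic.BallModel
open Summit.HodgeConjecture.CorCM.D2Bridge.UnitaryGroupConj
open MulAction

variable {L : Type} [Field L] [NumberField L] [IsCMField L] {H : Matrix (Fin 3) (Fin 3) L}
  {τ : L →+* ℂ} {T : GL (Fin 3) ℂ} {hT : formCongr (starRingEnd ℂ) T (H.map τ) = BallModel.J}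
  {K₀ : C5.OpenCompactSubgroup ↥(finAdelic (↥(maximalRealSubfield L)) L (IsCMField.complexConj L) 3 H)}

variable (τ) in
/-- CM: `τ ∘ c = conj ∘ τ` (Mathlib `IsCMField.complexEmbedding_complexConj`). [folklore] -/
theorem tau_comp_complexConj :
    τ.comp ((IsCMField.complexConj L : L ≃ₐ[↥(maximalRealSubfield L)] L) : L →+* L) = (conjAut : ℂ ≃+* ℂ).toRingHom.comp τ :=
  RingHom.ext fun x => IsCMField.complexEmbedding_complexConj L τ x

/-- The models of the conjugate complex record system of the complex shadow of `R` unfold to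
`c⁻¹(·) ⋙ (R.M ⋙ (·)_τ) ⋙ (·)^{conj}` (by `rfl`). [folklore] -/
theorem conjComplexRecordSystem_complexRecordSystem_Mc (R : RecordSystem L H τ T hT K₀) :
    (conjComplexRecordSystem R.complexRecordSystem).Mc =
      smallLevelConjBack L H K₀ ⋙ (R.M ⋙ baseChangeHom τ) ⋙ baseChangeHom (starRingAut : ℂ ≃+* ℂ).toRingHom :=
  rfl

/-- **Row A as ONE application** of `exists_conj_of_complexSide` at `Sc' := conjComplexRecordSystem R.complexRecordSystem`, with the
residual inputs `e ∕ Θ ∕ hE ∕ hP` as binders and (P_ℂ) already rewritten away by `conjComplexRecordSystem_pts_symm_mk_record`.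
[cite: Deligne1979ShimuraVarieties, 2.2.5] -/
theorem exists_conj_target (R : RecordSystem L H τ T hT K₀)
    (e : (conjModels R ⋙ baseChangeHom τ) ≅ (conjComplexRecordSystem R.complexRecordSystem).Mc)
    (Θ : letI : Algebra L ℂ := τ.toAlgebra
      ∀ K' : C5.SmallLevel (conjLevel₀ L H K₀),
        ComplexPoints ((conjModels R).obj K') ≃ ComplexPoints (R.M.obj ((smallLevelConjBack L H K₀).obj K')))
    (hE : letI : Algebra L ℂ := τ.toAlgebra
      ∀ (K' : C5.SmallLevel (conjLevel₀ L H K₀)) (σ : ℂ ≃ₐ[L] ℂ) (P : ComplexPoints ((conjModels R).obj K')),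
        Θ K' (σ • P) = conjAlgEquiv τ σ • Θ K' P)
    (hP : letI : Algebra L ℂ := τ.toAlgebra
      ∀ (K' : C5.SmallLevel (conjLevel₀ L H K₀)) (x : Ball)
        (a : finAdelic (↥(maximalRealSubfield L)) L (IsCMField.complexConj L) 3 (conjGram L H)),
        (AlgPoints.baseChangeEquiv τ ((conjModels R).obj K')).symm
            (AlgPoints.map (e.inv.app K')
              (toConjugate conjAut ((baseChangeHom τ).obj (R.M.obj ((smallLevelConjBack L H K₀).obj K')))
                (AlgPoints.baseChangeEquiv τ (R.M.obj ((smallLevelConjBack L H K₀).obj K'))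
                  ((R.pts ((smallLevelConjBack L H K₀).obj K')).symm
                    (ShimuraSet.mk L H τ T hT ((smallLevelConjBack L H K₀).obj K').1.1 (conjBall x)
                      ((groupConj L H).symm a)))))) =
          (Θ K').symm ((R.pts ((smallLevelConjBack L H K₀).obj K')).symm
            (ShimuraSet.mk L H τ T hT ((smallLevelConjBack L H K₀).obj K').1.1 (conjBall x) ((groupConj L H).symm a)))) :
    ∃ R' : RecordSystem L (conjGram L H) τ (conjFrame T) (formCongr_conjFrame L H τ T hT) (conjLevel₀ L H K₀),
      R'.M = conjModels R :=
  exists_conj_of_complexSide R (conjComplexRecordSystem R.complexRecordSystem) e Θ hE (fun K' x a => by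
    rw [conjComplexRecordSystem_pts_symm_mk_record]
    exact hP K' x a)

/-- **`e`**: `K' ↦ ((M_{c⁻¹K'} ⊗_{L,c} L) ⊗_{L,τ} ℂ ≅ (M_{c⁻¹K'} ⊗_{L,τ} ℂ) ⊗_{ℂ,conj} ℂ)`, the base-change swap of `RecordSystemConjSwap`,
natural in `K'`. [cite: GortzWedhorn2020, Prop. 4.16] -/
def eWitness (R : RecordSystem L H τ T hT K₀) :
    (conjModels R ⋙ baseChangeHom τ) ≅ (conjComplexRecordSystem R.complexRecordSystem).Mc :=
  NatIso.ofComponents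
    (fun K' => Ident2Witness.swapIso (tau_comp_complexConj τ) (R.M.obj ((smallLevelConjBack L H K₀).obj K')))
    (fun f => Ident2Witness.swapIso_natural (tau_comp_complexConj τ) (R.M.map ((smallLevelConjBack L H K₀).map f)))

/-- The one property of `e` the points side uses: `e⁻¹_{K'} ≫ pr_τ ≫ pr_c = pr_conj ≫ pr_τ` on underlying schemes. [folklore] -/
theorem eWitness_inv_app_left_fst (R : RecordSystem L H τ T hT K₀) (K' : C5.SmallLevel (conjLevel₀ L H K₀)) :
    ((eWitness R).inv.app K').left ≫
        baseChangeHomFst τ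
          ((baseChangeHom ((IsCMField.complexConj L : L ≃ₐ[↥(maximalRealSubfield L)] L) : L →+* L)).obj
            (R.M.obj ((smallLevelConjBack L H K₀).obj K'))) ≫
      baseChangeHomFst ((IsCMField.complexConj L : L ≃ₐ[↥(maximalRealSubfield L)] L) : L →+* L)
        (R.M.obj ((smallLevelConjBack L H K₀).obj K')) =
      AlgPoints.conjFst (starRingAut : ℂ ≃+* ℂ) ((baseChangeHom τ).obj (R.M.obj ((smallLevelConjBack L H K₀).obj K'))) ≫
        baseChangeHomFst τ (R.M.obj ((smallLevelConjBack L H K₀).obj K')) :=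
  Ident2Witness.swapIso_inv_left_fst (tau_comp_complexConj τ) (R.M.obj ((smallLevelConjBack L H K₀).obj K'))

/-- **Row A, `conjModels`-spelled**: the conjugate record system exists, with models `conjModels R`.
[cite: Deligne1979ShimuraVarieties, 2.2.5] [cite: Milne2005ShimuraVarieties, §12 (62)] -/
theorem exists_conj_witness (R : RecordSystem L H τ T hT K₀) :
    ∃ R' : RecordSystem L (conjGram L H) τ (conjFrame T) (formCongr_conjFrame L H τ T hT) (conjLevel₀ L H K₀),
      R'.M = conjModels R :=
  exists_conj_target R (eWitness R)
    (fun K' => Ident2Witness.theta (tau_comp_complexConj τ) (R.M.obj ((smallLevelConjBack L H K₀).obj K')))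
    (fun K' σ P => Ident2Witness.theta_smul (tau_comp_complexConj τ) (R.M.obj ((smallLevelConjBack L H K₀).obj K')) σ
      (conjAlgEquiv τ σ) (conjAlgEquiv_apply τ σ) P)
    (fun K' _ _ => Ident2Witness.baseChangeEquiv_symm_map_swapIso_inv_toConjugate (tau_comp_complexConj τ)
      (R.M.obj ((smallLevelConjBack L H K₀).obj K')) _)

/-- **`RecordSystemConj.exists_conj` — the RSCONJ TARGET (row A).**  For every Deligne record system `R` of `Sh(U(H), 𝔹²)` below `K₀`
there is a record system `R'` of the CONJUGATE space `(c(H), τ, T̄ = conjFrame T)` below `c(K₀)` whose model functor is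
`K' ↦ M_{c⁻¹K'} ⊗_{L,c} L` — the statement of mukey-p2's skeleton `RecordSystem.exists_conj` (0b87d68512da3d2b) verbatim.
[cite: Deligne1979ShimuraVarieties, 2.2.4–2.2.5] [cite: Milne2005ShimuraVarieties, §12 (62) and Lemma 5.13] -/
theorem exists_conj (R : RecordSystem L H τ T hT K₀) :
    ∃ R' : RecordSystem L (conjGram L H) τ (conjFrame T) (formCongr_conjFrame L H τ T hT) (conjLevel₀ L H K₀),
      R'.M = smallLevelConjBack L H K₀ ⋙ R.M ⋙
        baseChangeHom ((IsCMField.complexConj L : L ≃ₐ[↥(maximalRealSubfield L)] L) : L →+* L) :=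
  exists_conj_witness R

end Head

end Summit.HodgeConjecture.CorCM.Model.RecordSystemConj

/-! ## RSCONJ row R6 (ident-1): the END-facing SPACE corollaries with `hA` discharged by `exists_conj` -/

namespace Summit.HodgeConjecture.CorCM.D2Bridge.MuConjIdent

open CategoryTheory NumberField
open Literature.NumberTheory.Automorphic Literature.NumberTheory.Automorphic.UnitaryGroup
open Literature.AlgebraicGeometry.ShimuraVarieties.UnitaryCanonicalModel
open Literature.NumberTheory.Automorphic.Liu2021.AppendixC
open Summit.HodgeConjecture.CorCM.Model Summit.HodgeConjecture.CorCM.HComp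
open Summit.HodgeConjecture.CorCM.Model.RecordSystemConj

/-- **(e) BY CONSTRUCTION at the §4.2 datum of record** (`4 ≤ [F:ℚ]`): with RSCONJ's `exists_conj` at `R := recordOf h V h4` there is a
Deligne record `R'` of the CONJUGATE space `(c(V.Hm), ι₁, T̄)` below `c(K_f(3))` such that the §4.2 datum's system is its model functor
re-indexed (`c⁻¹(·) ⋙ ℭ.cpt.X = R'.M`) and `ℭ.X_K = R'.M_{c(K)}` at every level — `hA` of ✔ `exists_conjRecord_X_sec42DataOfFourLe_eq`
DISCHARGED.  HC_CM is NOT proved. [cite: Deligne1979ShimuraVarieties, 2.2.5 and Cor. 2.7.21] [cite: Liu2021, §4.2 and Prop. C.5] -/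
theorem exists_recordSystemConj_X_sec42DataOfFourLe_eq (h : exists_recordSystem) {F : CMField} {ι₁ : F →+* ℂ}
    (V : HermSpace3 F ι₁) (Φ : Literature.AlgebraicGeometry.Motives.CMType F) (h4 : 4 ≤ Module.finrank ℚ F) (iso : ℕ → Prop) :
    ∃ R' : RecordSystem F (conjGram F V.Hm) ι₁ (conjFrame (frameOf V))
        (formCongr_conjFrame F V.Hm ι₁ (frameOf V) (formCongr_frameOf V)) (conjLevel₀ F V.Hm (K3 V)),
      smallLevelConjBack F V.Hm (K3 V) ⋙ (sec42DataOfFourLe h V Φ h4 iso).cpt.X = R'.M ∧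
      ∀ K : C5.SmallLevel (K3 V), (sec42DataOfFourLe h V Φ h4 iso).X K =
        R'.M.obj (⟨C5.OpenCompactSubgroup.transport (groupConj F V.Hm) K.1, C5.OpenCompactSubgroup.transport_mono (groupConj F V.Hm) K.2⟩ :
          C5.SmallLevel (conjLevel₀ F V.Hm (K3 V))) :=
  exists_conjRecord_X_sec42DataOfFourLe_eq h V Φ h4 iso (smallLevelConjBack F V.Hm (K3 V))
    (fun K => ⟨C5.OpenCompactSubgroup.transport (groupConj F V.Hm) K.1, C5.OpenCompactSubgroup.transport_mono (groupConj F V.Hm) K.2⟩)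
    (fun K => Subtype.ext (OpenCompactSubgroup_transport_symm_transport (groupConj F V.Hm) K.1))
    (exists_conj (recordOf h V h4))

/-- **(e) BY CONSTRUCTION at the literal END datum** (`6 ≤ [F:ℚ]`, `ℭ := sec42DataOf h iso F ι₁ V Φ`, level `ℭ.levelOf K`): the same,
`hA` of ✔ `exists_conjRecord_X_sec42DataOf_levelOf_eq` DISCHARGED by `exists_conj (recordOf h V _)`.  HC_CM is NOT proved.
[cite: Deligne1979ShimuraVarieties, 2.2.5 and Cor. 2.7.21] [cite: Liu2021, §4.2, Thm. 4.18 (1) and Prop. C.5] -/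
theorem exists_recordSystemConj_X_sec42DataOf_levelOf_eq (h : exists_recordSystem) {F : CMField} {ι₁ : F →+* ℂ}
    (V : HermSpace3 F ι₁) (Φ : Literature.AlgebraicGeometry.Motives.CMType F)
    (iso : ∀ (F : CMField) (ι₁ : F →+* ℂ) (_ : HermSpace3 F ι₁) (_ : Literature.AlgebraicGeometry.Motives.CMType F), ℕ → Prop)
    (h6 : 6 ≤ Module.finrank ℚ F) :
    ∃ R' : RecordSystem F (conjGram F V.Hm) ι₁ (conjFrame (frameOf V))
        (formCongr_conjFrame F V.Hm ι₁ (frameOf V) (formCongr_frameOf V)) (conjLevel₀ F V.Hm (K3 V)),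
      smallLevelConjBack F V.Hm (K3 V) ⋙ (sec42DataOfFourLe h V Φ (le_trans (by norm_num) h6) (iso F ι₁ V Φ)).cpt.X = R'.M ∧
      ∀ K : Subgroup (honestP5Of h F ι₁ V Φ).G,
        (sec42DataOf h iso F ι₁ V Φ).X ((sec42DataOf h iso F ι₁ V Φ).levelOf K) =
          R'.M.obj (⟨C5.OpenCompactSubgroup.transport (groupConj F V.Hm)
              ((sec42DataOfFourLe h V Φ (le_trans (by norm_num) h6) (iso F ι₁ V Φ)).levelOf K).1,
            C5.OpenCompactSubgroup.transport_mono (groupConj F V.Hm)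
              ((sec42DataOfFourLe h V Φ (le_trans (by norm_num) h6) (iso F ι₁ V Φ)).levelOf K).2⟩ :
          C5.SmallLevel (conjLevel₀ F V.Hm (K3 V))) :=
  exists_conjRecord_X_sec42DataOf_levelOf_eq h V Φ iso h6 (smallLevelConjBack F V.Hm (K3 V))
    (fun K => ⟨C5.OpenCompactSubgroup.transport (groupConj F V.Hm) K.1, C5.OpenCompactSubgroup.transport_mono (groupConj F V.Hm) K.2⟩)
    (fun K => Subtype.ext (OpenCompactSubgroup_transport_symm_transport (groupConj F V.Hm) K.1))
    (exists_conj (recordOf h V (le_trans (by norm_num) h6)))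

end Summit.HodgeConjecture.CorCM.D2Bridge.MuConjIdent

end
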